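import Literature.NumberTheory.LFunctions.LargeValuesRFunction
import Literature.NumberTheory.LFunctions.LargeValuesGuthMaynardReduction
import Mathlib.Analysis.PSeries
import HarnessLib

/-!
# Sums over separated points: counting, decaying kernels, the sharp `L²` bound for `Ŵ`, fraction spacing

Topic `NumberTheory/LFunctions`, family RH. Tools for §11 (Lemma 11.8, "Small GCD terms") of
L. Guth, J. Maynard, *New large value estimates for Dirichlet polynomials*, Ann. of Math. 203 (2026),
in the programme around the tree's named fact `Literature.NumberTheory.LFunctions.zeroDensity_guth_maynard`
(reduced by `LargeValuesAssembly.lean` to Propositions 6.1, 10.1, 11.1). Everything is PROVED: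

* `card_le_of_sep`: `δ`-separated points in an interval of length `L` number `≤ L/δ + 1`;
  `card_shell_side_le`: the same for one shell `{m ≤ |x−c|/ρ < m+1}` on one side of a centre;
* `sum_kern_le`: for the model kernel `kern_{c,ρ}(x) = 1 (|x−c|<ρ), ρ²/(x−c)² (else)` and a finite
  `δ`-separated `X`, `∑_{x∈X} kern_{c,ρ}(x) ≤ 8(1 + ρ/δ)` uniformly in `c` (shells and `∑ 1/m² ≤ 2`);
* `sum_norm_fourier_le`: hence `∑_{x∈X} |Φ̂(u_x)| ≤ 8K(1 + 1/(Tδ))` when `|u_x| = T|x−c|`, for a smooth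
  compactly supported `Φ` (the kernel form of the count "`≲ 1 + N²/(d²T)`" of fractions near a point
  in the proof of Lemma 11.8);
* `L2_bound_sharp`: **the sharp `L²` bound** `|∫ Φ|Ŵ|²| ≤ C(1 + 1/δ)|W|` for finite `δ`-separated `W`
  (Guth–Maynard Lemma 8.2 in the form needed for the `1`-separated sets of §11; the generic
  `GuthMaynardRFunction.L2_bound` only gives `C|W| + C|W|²δ^{-j}`);
* `abs_sub_div_ge`, `abs_log_sub_log_ge`, `abs_log_div_sub_ge`: distinct fractions with denominators
  `≤ B` are `1/B²`-separated, and their logarithms (in `[1/2,2]`) are `1/(2B²)`-separated ("the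
  fractions `n₁'/n₂'` are `d²/N²`-separated").

Definitions (with bodies): `shell`, `kern`. No named fact is introduced.

## References

* L. Guth, J. Maynard, *New large value estimates for Dirichlet polynomials*, Ann. of Math. (2)
  203 (2026), no. 2; arXiv:2405.20552 (2024): Lemma 8.2; §11, Lemma 11.8 and its proof.
-/

noncomputable section

open Real Set Filter Topology Complex MeasureTheory Finset
open scoped FourierTransform ContDiff

namespace Literature.NumberTheory.LFunctions

namespace SeparatedSums

open GuthMaynardFourier GuthMaynardRFunction

/-! ## §1. Counting `δ`-separated points -/

/-- **`δ`-separated points in an interval of length `L` number at most `L/δ + 1`.** [folklore] -/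
theorem card_le_of_sep {δ L a : ℝ} (hδ : 0 < δ) (hL : 0 ≤ L) (X : Finset ℝ)
    (hX : ∀ x ∈ X, a ≤ x ∧ x ≤ a + L) (hsep : ∀ x ∈ X, ∀ x' ∈ X, x ≠ x' → δ ≤ |x - x'|) :
    (X.card : ℝ) ≤ L / δ + 1 := by
  classical
  set φ : ℝ → ℝ := fun x ↦ (x - a) / δ with hφ
  have hinj : Function.Injective φ := by
    intro x y h
    simp only [hφ] at h
    field_simp at h
    linarith
  have hcard : (X.image φ).card = X.card := Finset.card_image_of_injective _ hinj
  have h := GuthMaynardReduction.card_le_of_one_sep (T := L / δ) (by positivity) (X.image φ) ?_ ?_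
  · rw [hcard] at h; exact h
  · intro u hu
    rw [Finset.mem_image] at hu
    obtain ⟨x, hx, rfl⟩ := hu
    have := hX x hx
    constructor
    · exact div_nonneg (by linarith [this.1]) hδ.le
    · exact div_le_div_of_nonneg_right (by linarith [this.2]) hδ.le
  · intro u hu u' hu' hne
    rw [Finset.mem_image] at hu hu'
    obtain ⟨x, hx, rfl⟩ := hu
    obtain ⟨x', hx', rfl⟩ := hu'
    have hne' : x ≠ x' := fun h ↦ hne (by rw [h])
    have h1 := hsep x hx x' hx' hne'
    simp only [hφ]
    rw [← sub_div, abs_div, abs_of_pos hδ, le_div_iff₀ hδ, one_mul,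
      show x - a - (x' - a) = x - x' by ring]
    exact h1

/-- The shell index of `x` relative to the centre `c` at scale `ρ`: `⌊|x − c|/ρ⌋`. [folklore] -/
def shell (c ρ x : ℝ) : ℕ := ⌊|x - c| / ρ⌋₊

/-- Points of a `δ`-separated set in one shell `{m ≤ |x−c|/ρ < m+1}` on one side of `c` number at most
`ρ/δ + 1`. [folklore] -/
theorem card_shell_side_le {δ ρ c : ℝ} (hδ : 0 < δ) (hρ : 0 < ρ) (X : Finset ℝ)
    (hsep : ∀ x ∈ X, ∀ x' ∈ X, x ≠ x' → δ ≤ |x - x'|) (m : ℕ) (b : Bool) :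
    ((X.filter fun x ↦ shell c ρ x = m ∧ decide (c ≤ x) = b).card : ℝ) ≤ ρ / δ + 1 := by
  classical
  set Y := X.filter fun x ↦ shell c ρ x = m ∧ decide (c ≤ x) = b with hY
  have hYsep : ∀ x ∈ Y, ∀ x' ∈ Y, x ≠ x' → δ ≤ |x - x'| := fun x hx x' hx' hne ↦
    hsep x (Finset.mem_of_mem_filter _ hx) x' (Finset.mem_of_mem_filter _ hx') hne
  -- the shell on side `b` is contained in an interval of length `ρ`
  have hmem : ∀ x ∈ Y, (m : ℝ) ≤ |x - c| / ρ ∧ |x - c| / ρ < m + 1 ∧ decide (c ≤ x) = b := by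
    intro x hx
    rw [hY, Finset.mem_filter] at hx
    obtain ⟨_, hs, hb⟩ := hx
    rw [shell] at hs
    have h0 : 0 ≤ |x - c| / ρ := by positivity
    refine ⟨?_, ?_, hb⟩
    · rw [← hs]; exact Nat.floor_le h0
    · rw [← hs]; exact Nat.lt_floor_add_one _
  cases b with
  | true =>
    refine card_le_of_sep (a := c + m * ρ) hδ hρ.le Y (fun x hx ↦ ?_) hYsep
    obtain ⟨h1, h2, hb⟩ := hmem x hx
    simp only [decide_eq_true_eq] at hb
    rw [abs_of_nonneg (by linarith), le_div_iff₀ hρ] at h1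
    rw [abs_of_nonneg (by linarith), div_lt_iff₀ hρ] at h2
    constructor <;> nlinarith
  | false =>
    refine card_le_of_sep (a := c - (m + 1) * ρ) hδ hρ.le Y (fun x hx ↦ ?_) hYsep
    obtain ⟨h1, h2, hb⟩ := hmem x hx
    simp only [decide_eq_false_iff_not, not_le] at hb
    rw [abs_of_neg (by linarith), le_div_iff₀ hρ] at h1
    rw [abs_of_neg (by linarith), div_lt_iff₀ hρ] at h2
    constructor <;> nlinarith

/-! ## §2. Sums of a decaying kernel over `δ`-separated points -/

/-- The model kernel at scale `ρ` centred at `c`: `1` on `|x − c| < ρ`, `ρ²/(x−c)²` beyond. [folklore] -/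
def kern (c ρ x : ℝ) : ℝ := if |x - c| < ρ then 1 else ρ ^ 2 / (x - c) ^ 2

/-- `0 ≤ kern ≤ 1`. [folklore] -/
theorem kern_nonneg (c ρ x : ℝ) : 0 ≤ kern c ρ x := by
  unfold kern; split_ifs <;> positivity

/-- On the shell `m ≥ 1`, `kern ≤ 1/m²`; on shell `0`, `kern ≤ 1`. [folklore] -/
theorem kern_le_inv_sq {c ρ x : ℝ} (hρ : 0 < ρ) {m : ℕ} (hm : shell c ρ x = m) (hm1 : 1 ≤ m) :
    kern c ρ x ≤ 1 / (m : ℝ) ^ 2 := by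
  have h0 : 0 ≤ |x - c| / ρ := by positivity
  have h1 : (m : ℝ) ≤ |x - c| / ρ := by rw [← hm]; exact Nat.floor_le h0
  rw [le_div_iff₀ hρ] at h1
  have hm0 : (1 : ℝ) ≤ m := by exact_mod_cast hm1
  have hxc : ρ ≤ |x - c| := by
    have : (1 : ℝ) * ρ ≤ m * ρ := mul_le_mul_of_nonneg_right hm0 hρ.le
    linarith
  have hpos : 0 < |x - c| := lt_of_lt_of_le hρ hxc
  unfold kern
  rw [if_neg (not_lt.mpr hxc), ← sq_abs (x - c), div_le_div_iff₀ (by positivity) (by positivity),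
    one_mul]
  have := mul_self_le_mul_self (by positivity) h1
  nlinarith

/-- `kern ≤ 1`. [folklore] -/
theorem kern_le_one (c ρ x : ℝ) (hρ : 0 < ρ) : kern c ρ x ≤ 1 := by
  unfold kern
  split_ifs with h
  · exact le_rfl
  · push Not at h
    have hpos : 0 < |x - c| := lt_of_lt_of_le hρ h
    rw [← sq_abs (x - c), div_le_one (by positivity)]
    exact pow_le_pow_left₀ hρ.le h 2

/-- **A decaying kernel summed over a `δ`-separated set**: for `X` finite and `δ`-separated, `ρ > 0`
and any centre `c`, `∑_{x∈X} kern_{c,ρ}(x) ≤ 8(1 + ρ/δ)`. [folklore] -/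
theorem sum_kern_le {δ ρ : ℝ} (hδ : 0 < δ) (hρ : 0 < ρ) (X : Finset ℝ)
    (hsep : ∀ x ∈ X, ∀ x' ∈ X, x ≠ x' → δ ≤ |x - x'|) (c : ℝ) :
    ∑ x ∈ X, kern c ρ x ≤ 8 * (1 + ρ / δ) := by
  classical
  -- group the points by (shell, side)
  set key : ℝ → ℕ × Bool := fun x ↦ (shell c ρ x, decide (c ≤ x)) with hkey
  set w : ℕ × Bool → ℝ := fun p ↦ if p.1 = 0 then 1 else 1 / (p.1 : ℝ) ^ 2 with hw
  have hw0 : ∀ p, 0 ≤ w p := fun p ↦ by simp only [hw]; split_ifs <;> positivity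
  have hpt : ∀ x ∈ X, kern c ρ x ≤ w (key x) := by
    intro x _
    simp only [hkey, hw]
    split_ifs with h
    · exact kern_le_one c ρ x hρ
    · exact kern_le_inv_sq hρ rfl (Nat.one_le_iff_ne_zero.mpr h)
  -- sum fiberwise
  have hfib : ∑ x ∈ X, w (key x) =
      ∑ p ∈ X.image key, ((X.filter fun x ↦ key x = p).card : ℝ) * w p := by
    rw [← Finset.sum_fiberwise_of_maps_to (s := X) (t := X.image key) (g := key)
      (fun x hx ↦ Finset.mem_image_of_mem key hx) (f := fun x ↦ w (key x))]
    refine Finset.sum_congr rfl fun p _ ↦ ?_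
    have : ∀ x ∈ X.filter (fun x ↦ key x = p), w (key x) = w p := fun x hx ↦ by
      rw [(Finset.mem_filter.mp hx).2]
    rw [Finset.sum_congr rfl this, Finset.sum_const, nsmul_eq_mul]
  have hcardp : ∀ p : ℕ × Bool, ((X.filter fun x ↦ key x = p).card : ℝ) ≤ ρ / δ + 1 := by
    intro p
    have h := card_shell_side_le (c := c) hδ hρ X hsep p.1 p.2
    have heq : (X.filter fun x ↦ key x = p) =
        X.filter fun x ↦ shell c ρ x = p.1 ∧ decide (c ≤ x) = p.2 := by
      refine Finset.filter_congr fun x _ ↦ ?_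
      simp only [hkey, Prod.ext_iff]
    rw [heq]; exact h
  -- the total weight of all (shell, side) pairs is at most `6`
  set M : ℕ := X.sup (shell c ρ) with hM
  have hsub : X.image key ⊆ (Finset.range (M + 1)) ×ˢ (Finset.univ : Finset Bool) := by
    intro p hp
    rw [Finset.mem_image] at hp
    obtain ⟨x, hx, rfl⟩ := hp
    simp only [hkey, Finset.mem_product, Finset.mem_range, Finset.mem_univ, and_true]
    exact Nat.lt_succ_of_le (Finset.le_sup (f := shell c ρ) hx)
  have hwsum : ∑ p ∈ (Finset.range (M + 1)) ×ˢ (Finset.univ : Finset Bool), w p ≤ 6 := by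
    rw [Finset.sum_product]
    have h1 : ∀ m ∈ Finset.range (M + 1), ∑ b : Bool, w (m, b) =
        2 * (if m = 0 then (1 : ℝ) else 1 / (m : ℝ) ^ 2) := by
      intro m _
      simp only [hw, Fintype.sum_bool]; ring
    rw [Finset.sum_congr rfl h1, ← Finset.mul_sum, Finset.range_eq_Ico,
      Finset.sum_eq_sum_Ico_succ_bot (Nat.succ_pos M)]
    simp only [if_true]
    have h2 : ∑ m ∈ Finset.Ico 1 (M + 1), (if m = 0 then (1 : ℝ) else 1 / (m : ℝ) ^ 2) =
        ∑ m ∈ Finset.Ioo 0 (M + 1), ((m : ℝ) ^ 2)⁻¹ := by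
      rw [show Finset.Ico 1 (M + 1) = Finset.Ioo 0 (M + 1) from rfl]
      refine Finset.sum_congr rfl fun m hm ↦ ?_
      rw [Finset.mem_Ioo] at hm
      rw [if_neg (by omega), one_div]
    have h3 := sum_Ioo_inv_sq_le (α := ℝ) 0 (M + 1)
    rw [h2]
    norm_num at h3 ⊢
    linarith
  -- combine
  calc ∑ x ∈ X, kern c ρ x ≤ ∑ x ∈ X, w (key x) := Finset.sum_le_sum hpt
    _ = ∑ p ∈ X.image key, ((X.filter fun x ↦ key x = p).card : ℝ) * w p := hfib
    _ ≤ ∑ p ∈ X.image key, (ρ / δ + 1) * w p :=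
        Finset.sum_le_sum fun p _ ↦ mul_le_mul_of_nonneg_right (hcardp p) (hw0 p)
    _ ≤ ∑ p ∈ (Finset.range (M + 1)) ×ˢ (Finset.univ : Finset Bool), (ρ / δ + 1) * w p :=
        Finset.sum_le_sum_of_subset_of_nonneg hsub fun p _ _ ↦ by
          have := hw0 p; positivity
    _ = (ρ / δ + 1) * ∑ p ∈ (Finset.range (M + 1)) ×ˢ (Finset.univ : Finset Bool), w p := by
        rw [Finset.mul_sum]
    _ ≤ (ρ / δ + 1) * 6 := by gcongr
    _ ≤ 8 * (1 + ρ / δ) := by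
        have : 0 ≤ ρ / δ := by positivity
        nlinarith

/-! ## §3. Fourier kernels over separated points; the sharp `L²` bound for `Ŵ` -/

/-- A smooth compactly supported `Φ` has `|Φ̂(u)| ≤ K · kern_{c,1/T}(x)` whenever `|u| = T|x − c|`
(`T > 0`). [folklore] -/
theorem norm_fourier_le_kern {Φ : ℝ → ℂ} (hΦ : ContDiff ℝ ∞ Φ) (hΦs : HasCompactSupport Φ) :
    ∃ K, 0 ≤ K ∧ ∀ (T : ℝ), 0 < T → ∀ c x u : ℝ, |u| = T * |x - c| →
      ‖𝓕 Φ u‖ ≤ K * kern c (1 / T) x := by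
  obtain ⟨K, hK0, hKb, hKd⟩ := fourier_decay hΦ hΦs 2
  refine ⟨K, hK0, fun T hT c x u hu ↦ ?_⟩
  unfold kern
  split_ifs with h
  · rw [mul_one]; exact hKb _
  · push Not at h
    have hxc : 0 < |x - c| := lt_of_lt_of_le (by positivity) h
    have hne : u ≠ 0 := by
      intro h0; rw [h0, abs_zero] at hu
      have : 0 < T * |x - c| := by positivity
      linarith
    refine (hKd _ hne).trans (le_of_eq ?_)
    rw [hu, mul_pow, ← sq_abs (x - c)]
    field_simp

/-- **A Fourier kernel summed over `δ`-separated points**: if `|u_x| = T|x − c|` for `x ∈ X` then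
`∑_{x∈X} |Φ̂(u_x)| ≤ 8K(1 + 1/(Tδ))`, uniformly in the centre `c` (the count "`≲ 1 + N²/(d²T)`" of
fractions near a point in the proof of Lemma 11.8, in kernel form).
[cite: GuthMaynard2026, proof of Lemma 11.8] -/
theorem sum_norm_fourier_le {Φ : ℝ → ℂ} (hΦ : ContDiff ℝ ∞ Φ) (hΦs : HasCompactSupport Φ) :
    ∃ K, 0 ≤ K ∧ ∀ (T δ : ℝ), 0 < T → 0 < δ → ∀ (X : Finset ℝ),
      (∀ x ∈ X, ∀ x' ∈ X, x ≠ x' → δ ≤ |x - x'|) → ∀ (c : ℝ) (u : ℝ → ℝ),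
      (∀ x ∈ X, |u x| = T * |x - c|) →
      ∑ x ∈ X, ‖𝓕 Φ (u x)‖ ≤ 8 * K * (1 + 1 / (T * δ)) := by
  obtain ⟨K, hK0, hK⟩ := norm_fourier_le_kern hΦ hΦs
  refine ⟨K, hK0, fun T δ hT hδ X hsep c u hu ↦ ?_⟩
  calc ∑ x ∈ X, ‖𝓕 Φ (u x)‖ ≤ ∑ x ∈ X, K * kern c (1 / T) x :=
        Finset.sum_le_sum fun x hx ↦ hK T hT c x (u x) (hu x hx)
    _ = K * ∑ x ∈ X, kern c (1 / T) x := by rw [Finset.mul_sum]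
    _ ≤ K * (8 * (1 + (1 / T) / δ)) :=
        mul_le_mul_of_nonneg_left (sum_kern_le hδ (by positivity) X hsep c) hK0
    _ = 8 * K * (1 + 1 / (T * δ)) := by rw [div_div]; ring

/-- **The sharp `L²` bound for `Ŵ` on a `δ`-separated set** (Guth–Maynard Lemma 8.2 in the form needed
for `1`-separated `W`, §11): for a smooth compactly supported test function `Φ` there is `C` with
`|∫ Φ(τ)|Ŵ(τ)|² dτ| ≤ C (1 + 1/δ) |W|` for every finite `δ`-separated `W` — the off-diagonal terms
`Φ̂(t₁−t₂)` are summed with the decay `|Φ̂(u)| ≪ min(1, u^{-2})` over the `δ`-separated `t₂`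
("the terms with `t₁ ≠ t₂` are negligible. The terms with `t₁ = t₂` contribute `≪ |W|`").
[cite: GuthMaynard2026, Lemma 8.2] -/
theorem L2_bound_sharp {Φ : ℝ → ℂ} (hΦ : ContDiff ℝ ∞ Φ) (hΦs : HasCompactSupport Φ) :
    ∃ C, 0 ≤ C ∧ ∀ (W : Finset ℝ) (δ : ℝ), 0 < δ →
      (∀ t ∈ W, ∀ t' ∈ W, t ≠ t' → δ ≤ |t - t'|) →
      ‖∫ τ, Φ τ * (((‖trigPoly W τ‖ ^ 2 : ℝ)) : ℂ)‖ ≤ C * (1 + 1 / δ) * W.card := by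
  obtain ⟨K, hK0, hK⟩ := sum_norm_fourier_le hΦ hΦs
  refine ⟨8 * K, by positivity, fun W δ hδ hsep ↦ ?_⟩
  have h0 : Integrable Φ := hΦ.continuous.integrable_of_hasCompactSupport hΦs
  rw [integral_mul_normSq_trigPoly h0]
  calc ‖∑ t₁ ∈ W, ∑ t₂ ∈ W, 𝓕 Φ (t₁ - t₂)‖ ≤ ∑ t₁ ∈ W, ‖∑ t₂ ∈ W, 𝓕 Φ (t₁ - t₂)‖ := norm_sum_le _ _
    _ ≤ ∑ t₁ ∈ W, ∑ t₂ ∈ W, ‖𝓕 Φ (t₁ - t₂)‖ := Finset.sum_le_sum fun _ _ ↦ norm_sum_le _ _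
    _ ≤ ∑ t₁ ∈ W, 8 * K * (1 + 1 / (1 * δ)) := by
        refine Finset.sum_le_sum fun t₁ _ ↦ ?_
        refine hK 1 δ one_pos hδ W hsep t₁ (fun t₂ ↦ t₁ - t₂) fun t₂ _ ↦ ?_
        rw [one_mul, abs_sub_comm]
    _ = 8 * K * (1 + 1 / δ) * W.card := by
        rw [Finset.sum_const, nsmul_eq_mul, one_mul]; ring

/-! ## §4. Spacing of fractions and of their logarithms -/

/-- **Distinct fractions with denominators `≤ B` are `1/B²`-separated**: for naturals with
`1 ≤ b, b' ≤ B` and `a/b ≠ a'/b'`, `|a/b − a'/b'| ≥ 1/B²` ("the fractions `n₁'/n₂'` are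
`d²/N²`-separated"). [cite: GuthMaynard2026, proof of Lemma 11.8] -/
theorem abs_sub_div_ge {a b a' b' : ℕ} {B : ℝ} (hb : 1 ≤ b) (hb' : 1 ≤ b') (hbB : (b : ℝ) ≤ B)
    (hb'B : (b' : ℝ) ≤ B) (hne : (a : ℝ) / b ≠ (a' : ℝ) / b') :
    1 / B ^ 2 ≤ |(a : ℝ) / b - (a' : ℝ) / b'| := by
  have hb0 : (0 : ℝ) < b := by exact_mod_cast hb
  have hb'0 : (0 : ℝ) < b' := by exact_mod_cast hb'
  have hB : (0 : ℝ) < B := lt_of_lt_of_le hb0 hbB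
  have hnum : ((a : ℤ) * b' - (a' : ℤ) * b : ℤ) ≠ 0 := by
    intro h
    apply hne
    rw [div_eq_div_iff hb0.ne' hb'0.ne']
    have : ((a : ℤ) * b' : ℤ) = (a' : ℤ) * b := by linarith
    exact_mod_cast this
  have h1 : (1 : ℝ) ≤ |((a : ℝ) * b' - (a' : ℝ) * b)| := by
    have : (1 : ℤ) ≤ |(a : ℤ) * b' - (a' : ℤ) * b| := Int.one_le_abs hnum
    have := (Int.cast_le (R := ℝ)).mpr this
    push_cast at this
    exact this
  have h2 : (a : ℝ) / b - (a' : ℝ) / b' = ((a : ℝ) * b' - (a' : ℝ) * b) / (b * b') := by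
    field_simp
  rw [h2, abs_div, abs_of_pos (by positivity : (0 : ℝ) < b * b'), le_div_iff₀ (by positivity)]
  calc 1 / B ^ 2 * (b * b') ≤ 1 / B ^ 2 * (B * B) := by gcongr
    _ = 1 := by field_simp
    _ ≤ _ := h1

/-- **`log` is `1/2`-bi-Lipschitz from below on `[1/2, 2]`**: `|log x − log x'| ≥ |x − x'|/2` for
`x, x' ∈ [1/2, 2]`. [folklore] -/
theorem abs_log_sub_log_ge {x x' : ℝ} (hx : 1 / 2 ≤ x) (hx2 : x ≤ 2) (hx' : 1 / 2 ≤ x') (hx'2 : x' ≤ 2) :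
    |x - x'| / 2 ≤ |Real.log x - Real.log x'| := by
  have hx0 : 0 < x := by linarith
  have hx'0 : 0 < x' := by linarith
  -- `log y ≥ 1 − 1/y` applied to `y = x/x'` and `y = x'/x`
  have key : ∀ {y z : ℝ}, 0 < y → 0 < z → z ≤ 2 → y ≤ z → (z - y) / 2 ≤ Real.log z - Real.log y := by
    intro y z hy hz hz2 hyz
    have h := Real.one_sub_inv_le_log_of_pos (x := z / y) (by positivity)
    rw [Real.log_div hz.ne' hy.ne', inv_div] at h
    have e : 1 - y / z = (z - y) / z := by field_simp
    rw [e] at h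
    have : (z - y) / 2 ≤ (z - y) / z :=
      div_le_div_of_nonneg_left (by linarith) hz hz2
    linarith
  rcases le_or_gt x x' with h | h
  · rw [abs_of_nonpos (by linarith), abs_of_nonpos (by linarith [Real.log_le_log hx0 h]), neg_sub,
      neg_sub]
    exact key hx0 hx'0 hx'2 h
  · rw [abs_of_pos (by linarith), abs_of_nonneg (by linarith [Real.log_le_log hx'0 h.le])]
    exact key hx'0 hx0 hx2 h.le

/-- **Distinct fractions in `[1/2, 2]` with denominators `≤ B` have `1/(2B²)`-separated logarithms**
(so the points `τ = −log(n₁'/n₂')/2π` of the proof of Lemma 11.8 are `d²/(16πN²)`-separated).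
[cite: GuthMaynard2026, proof of Lemma 11.8] -/
theorem abs_log_div_sub_ge {a b a' b' : ℕ} {B : ℝ} (hb : 1 ≤ b) (hb' : 1 ≤ b') (hbB : (b : ℝ) ≤ B)
    (hb'B : (b' : ℝ) ≤ B) (hne : (a : ℝ) / b ≠ (a' : ℝ) / b')
    (h1 : 1 / 2 ≤ (a : ℝ) / b) (h2 : (a : ℝ) / b ≤ 2) (h1' : 1 / 2 ≤ (a' : ℝ) / b')
    (h2' : (a' : ℝ) / b' ≤ 2) :
    1 / (2 * B ^ 2) ≤ |Real.log ((a : ℝ) / b) - Real.log ((a' : ℝ) / b')| := by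
  have hA := abs_sub_div_ge hb hb' hbB hb'B hne
  have hL := abs_log_sub_log_ge h1 h2 h1' h2'
  have : 1 / (2 * B ^ 2) = (1 / B ^ 2) / 2 := by ring
  rw [this]
  linarith

end SeparatedSums

end Literature.NumberTheory.LFunctions

end
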